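import Literature.NumberTheory.ModularForms.ThetaFourthOrder
import HarnessLib

/-!
# Third-order asymptotics of `𝓛_S` and `𝓛` at `i∞` (CKMRV (2.10))

Cohn–Kumar–Miller–Radchenko–Viazovska, arXiv:1902.05438, §2.1.2 (2.10):
`𝓛 = πiz + 4 log 2 − 8q^{1/2} + O(q)`, `𝓛_S = −16q^{1/2} − (64/3)q^{3/2} + O(q^{5/2})`.

Everything below is proved (`IsBigO` along `atImInfty`, `b = qhalf = e^{πiτ}`):
* `log_one_add_taylor2_isBigO`: `log(1 + w) − w + w²/2 = O(e^{−3πy})` for `w = O(e^{−πy})`;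
* `logLambdaS_third_order`: `𝓛_S + 16q^{1/2} = O(e^{−3πy})` (no `q`-term, as in (2.10));
* `logLambda_third_order`: `𝓛 − πiτ − log 16 + 8q^{1/2} − 12q = O(e^{−3πy})` (the `q`-coefficient
  `12 = 44 − 32` comes from `λ/(16q^{1/2}) = 1 − 8q^{1/2} + 44q + O(q^{3/2})`; (2.10) prints only
  the orders `≤ q^{1/2}`).

## References

* H. Cohn, A. Kumar, S. D. Miller, D. Radchenko, M. Viazovska, Ann. of Math. 196 (2022),
  arXiv:1902.05438, §2.1.2 (2.9)–(2.10). [CohnEtAl2019]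
-/

noncomputable section

open Complex hiding I
open Filter Topology Asymptotics ModularForm SlashInvariantForm
open UpperHalfPlane hiding I
open Complex (I)
open scoped Real MatrixGroups ModularForm Manifold

namespace Literature.NumberTheory.ModularForms

/-- `log(1 + w) − w + w²/2 = O(w³)` transported: `w = O(e^{−πy})` ⟹ `= O(e^{−3πy})`. [folklore] -/
theorem log_one_add_taylor2_isBigO {w : ℍ → ℂ} (hw : w =O[atImInfty] fun τ => expDecayHalf τ) :
    (fun τ => Complex.log (1 + w τ) - w τ + w τ ^ 2 / 2) =O[atImInfty] fun τ => expDecayHalf τ ^ 3 := by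
  have hw0 : Tendsto w atImInfty (𝓝 0) := hw.trans_tendsto tendsto_expDecayHalf
  have hev : ∀ᶠ τ : ℍ in atImInfty, ‖w τ‖ ≤ 1 / 2 := by
    have := (continuous_norm.tendsto (0 : ℂ)).comp hw0
    rw [norm_zero] at this
    exact this.eventually (eventually_le_nhds (by norm_num : (0 : ℝ) < 1 / 2))
  have h2 : (fun τ => Complex.log (1 + w τ) - w τ + w τ ^ 2 / 2) =O[atImInfty] fun τ => ‖w τ‖ ^ 3 := by
    refine IsBigO.of_bound 1 ?_
    filter_upwards [hev] with τ hτ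
    have h := Complex.norm_log_sub_logTaylor_le 2 (z := w τ) (by linarith)
    have htaylor : Complex.logTaylor 3 (w τ) = w τ - w τ ^ 2 / 2 := by
      simp [Complex.logTaylor, Finset.sum_range_succ]
      ring
    rw [htaylor, show Complex.log (1 + w τ) - (w τ - w τ ^ 2 / 2) = Complex.log (1 + w τ) - w τ + w τ ^ 2 / 2 by ring] at h
    rw [Real.norm_of_nonneg (pow_nonneg (norm_nonneg _) 3), one_mul]
    refine h.trans ?_
    have : (1 - ‖w τ‖)⁻¹ ≤ 2 := by
      rw [inv_le_comm₀ (by linarith) (by norm_num)]; linarith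
    have h3 : 0 ≤ ‖w τ‖ ^ 3 := pow_nonneg (norm_nonneg _) 3
    calc ‖w τ‖ ^ (2 + 1) * (1 - ‖w τ‖)⁻¹ / (2 + 1) ≤ ‖w τ‖ ^ 3 * 2 / 3 := by
          rw [show (2 : ℕ) + 1 = 3 by norm_num]
          exact div_le_div_of_nonneg_right (mul_le_mul_of_nonneg_left this h3) (by norm_num) |>.trans (by norm_num)
      _ ≤ ‖w τ‖ ^ 3 := by nlinarith
  have h3 : (fun τ => ‖w τ‖ ^ 3) =O[atImInfty] fun τ => expDecayHalf τ ^ 3 := by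
    simpa using hw.norm_left.pow 3
  exact h2.trans h3

/-- **`𝓛_S + 16q^{1/2} = O(e^{−3πy})`** (CKMRV (2.10): `𝓛_S = −16q^{1/2} − (64/3)q^{3/2} + ⋯`, no
`q`-term): `log(1 − λ) = −λ − λ²/2 + O(λ³)` and `λ = 16b − 128b² + O(b³)` give
`−λ − λ²/2 = −16b + 128b² − 128b² + O(b³)`. [cite: CohnEtAl2019, §2.1.2 (2.10)] -/
theorem logLambdaS_third_order :
    (fun τ : ℍ => logLambdaS τ + 16 * qhalf τ) =O[atImInfty] fun τ => expDecayHalf τ ^ 3 := by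
  have hl := modularLambda_isBigO
  have hl2 := modularLambda_second_order   -- `λ − 16b + 128b² = O(b³)`
  have hq := qhalf_isBigO
  have hq1 := qhalf_isBigO_one
  have hev : ∀ᶠ τ : ℍ in atImInfty, logLambdaS τ = Complex.log (1 + -modularLambda τ) := by
    have h0 := tendsto_logLambdaS_atImInfty
    have : ∀ᶠ τ : ℍ in atImInfty, ‖logLambdaS τ‖ < 1 := by
      have := (continuous_norm.tendsto (0 : ℂ)).comp h0
      rw [norm_zero] at this
      exact this.eventually (eventually_lt_nhds (by norm_num : (0 : ℝ) < 1))
    filter_upwards [this] with τ hτ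
    have him : |(logLambdaS τ).im| < π := by
      have := (abs_im_le_norm (logLambdaS τ)).trans_lt hτ
      linarith [Real.pi_gt_three]
    rw [← sub_eq_add_neg, ← cexp_logLambdaS τ, Complex.log_exp (by linarith [abs_lt.1 him |>.1])
      (by linarith [abs_lt.1 him |>.2])]
  have h1 := log_one_add_taylor2_isBigO (w := fun τ => -modularLambda τ) hl.neg_left
  -- `λ² − 256b² = (λ − 16b)(λ + 16b)` with `λ − 16b = O(b²)`, so `λ²/2 − 128b² = O(b³)`
  have hl1 : (fun τ => modularLambda τ - 16 * qhalf τ) =O[atImInfty] fun τ => expDecayHalf τ ^ 2 := modularLambda_sub_isBigO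
  have hsq : (fun τ => (modularLambda τ - 16 * qhalf τ) * (modularLambda τ + 16 * qhalf τ)) =O[atImInfty]
      fun τ => expDecayHalf τ ^ 3 := by
    have hb : (fun τ => modularLambda τ + 16 * qhalf τ) =O[atImInfty] fun τ => expDecayHalf τ := hl.add (hq.const_mul_left 16)
    have := hl1.mul hb
    exact this.congr_right fun τ => by ring
  -- `𝓛_S + 16b = [log(1−λ) + λ + λ²/2] − ½[λ² − 256b²] − [λ − 16b + 128b²]`
  have total := (h1.sub (hsq.const_mul_left (1 / 2 : ℂ))).sub hl2
  refine total.congr' ?_ EventuallyEq.rfl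
  filter_upwards [hev] with τ hτ
  rw [hτ]; ring

/-- **`𝓛 − πiτ − log 16 + 8q^{1/2} − 12q = O(e^{−3πy})`** (extends CKMRV (2.10) by one order):
`𝓛 − πiτ − log 16 = log(1 + w)` with `w = λe^{−πiτ}/16 − 1 = −8b + 44b² + O(b³)`, and
`log(1 + w) = w − w²/2 + O(w³) = −8b + (44 − 32)b² + O(b³)`. [cite: CohnEtAl2019, §2.1.2 (2.10)] -/
theorem logLambda_third_order :
    (fun τ : ℍ => logLambda τ - π * I * τ - (Real.log 16 : ℝ) + 8 * qhalf τ - 12 * qhalf τ ^ 2) =O[atImInfty]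
      fun τ => expDecayHalf τ ^ 3 := by
  set w : ℍ → ℂ := fun τ => modularLambda τ * cexp (-(π * I * τ)) / 16 - 1 with hw
  have hq0 : ∀ τ : ℍ, qhalf τ ≠ 0 := fun τ => Complex.exp_ne_zero _
  have hqinv : ∀ τ : ℍ, cexp (-(π * I * (τ : ℂ))) = (qhalf τ)⁻¹ := fun τ => by rw [qhalf, Complex.exp_neg]
  have hq := qhalf_isBigO
  have hq1 := qhalf_isBigO_one
  -- `w + 8b − 44b² = (λ − 16b + 128b² − 704b³)/(16b)`: `O(b³)`
  have hw3 : (fun τ => w τ + 8 * qhalf τ - 44 * qhalf τ ^ 2) =O[atImInfty] fun τ => expDecayHalf τ ^ 3 := by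
    have h := modularLambda_fourth_order
    obtain ⟨C, hC⟩ := h.bound
    have hform : ∀ τ : ℍ, w τ + 8 * qhalf τ - 44 * qhalf τ ^ 2 =
        (modularLambda τ - 16 * qhalf τ + 128 * qhalf τ ^ 2 - 704 * qhalf τ ^ 3) * (qhalf τ)⁻¹ / 16 := by
      intro τ
      have := hq0 τ
      simp only [hw, hqinv]
      field_simp
      ring
    refine IsBigO.of_bound (C / 16) ?_
    filter_upwards [hC] with τ hτ
    rw [Real.norm_of_nonneg (pow_nonneg (expDecayHalf_pos τ).le 4)] at hτ
    rw [hform, Real.norm_of_nonneg (pow_nonneg (expDecayHalf_pos τ).le 3), norm_div, norm_mul, norm_inv, norm_qhalf,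
      show ‖(16 : ℂ)‖ = 16 by norm_num]
    have hr := expDecayHalf_pos τ
    rw [div_le_iff₀ (by norm_num : (0 : ℝ) < 16), mul_inv_le_iff₀ hr]
    calc ‖modularLambda τ - 16 * qhalf τ + 128 * qhalf τ ^ 2 - 704 * qhalf τ ^ 3‖ ≤ C * expDecayHalf τ ^ 4 := hτ
      _ = C / 16 * expDecayHalf τ ^ 3 * 16 * expDecayHalf τ := by ring
  have hw1 : w =O[atImInfty] fun τ => expDecayHalf τ := by
    have h3 := hw3.trans (expDecayHalf_pow_isBigO (m := 3) (by norm_num))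
    have h8 : (fun τ => 8 * qhalf τ) =O[atImInfty] fun τ => expDecayHalf τ := hq.const_mul_left 8
    have h44 : (fun τ => 44 * qhalf τ ^ 2) =O[atImInfty] fun τ => expDecayHalf τ := by
      have : (fun τ => qhalf τ ^ 2) =O[atImInfty] fun τ => expDecayHalf τ := by
        simpa [sq] using (isBigO_mul_of_isBigO_one hq1 hq)
      exact this.const_mul_left 44
    exact ((h3.sub h8).add h44).congr_left fun τ => by ring
  have hw2 : (fun τ => w τ + 8 * qhalf τ) =O[atImInfty] fun τ => expDecayHalf τ ^ 2 := by
    have h3 := hw3.trans (expDecayHalf_pow_isBigO_pow (m := 3) (n := 2) (by norm_num))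
    have h44 : (fun τ => 44 * qhalf τ ^ 2) =O[atImInfty] fun τ => expDecayHalf τ ^ 2 := by
      simpa [sq] using (hq.mul hq).const_mul_left 44
    exact (h3.add h44).congr_left fun τ => by ring
  have hlog := log_one_add_taylor2_isBigO hw1
  -- `w² − 64b² = (w + 8b)(w − 8b) = O(b³)`
  have hsq : (fun τ => (w τ + 8 * qhalf τ) * (w τ - 8 * qhalf τ)) =O[atImInfty] fun τ => expDecayHalf τ ^ 3 := by
    have hb : (fun τ => w τ - 8 * qhalf τ) =O[atImInfty] fun τ => expDecayHalf τ := hw1.sub (hq.const_mul_left 8)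
    have := hw2.mul hb
    exact this.congr_right fun τ => by ring
  -- eventually `𝓛 − πiτ − log 16 = log(1 + w)`
  have hev : ∀ᶠ τ : ℍ in atImInfty, logLambda τ - π * I * τ - (Real.log 16 : ℝ) = Complex.log (1 + w τ) := by
    have h0 : Tendsto (fun τ : ℍ => logLambda τ - π * I * τ - (Real.log 16 : ℝ)) atImInfty (𝓝 0) := by
      have := tendsto_logLambda_sub_atImInfty.sub_const (((Real.log 16 : ℝ)) : ℂ)
      rwa [sub_self] at this
    have : ∀ᶠ τ : ℍ in atImInfty, ‖logLambda τ - π * I * τ - (Real.log 16 : ℝ)‖ < 1 := by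
      have := (continuous_norm.tendsto (0 : ℂ)).comp h0
      rw [norm_zero] at this
      exact this.eventually (eventually_lt_nhds (by norm_num : (0 : ℝ) < 1))
    filter_upwards [this] with τ hτ
    set G := logLambda τ - π * I * τ - (Real.log 16 : ℝ) with hG
    have him : |G.im| < π := by
      have := (abs_im_le_norm G).trans_lt hτ
      linarith [Real.pi_gt_three]
    have h16 : cexp ((Real.log 16 : ℝ) : ℂ) = 16 := by
      rw [← Complex.ofReal_exp, Real.exp_log (by norm_num)]; norm_num
    have hexpG : cexp G = 1 + w τ := by
      rw [hG, sub_eq_add_neg, sub_eq_add_neg, Complex.exp_add, Complex.exp_add, cexp_logLambda,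
        Complex.exp_neg ((Real.log 16 : ℝ) : ℂ), h16, hw]
      ring
    rw [← hexpG, Complex.log_exp (by linarith [abs_lt.1 him |>.1]) (by linarith [abs_lt.1 him |>.2])]
  -- `𝓛 − πiτ − log16 + 8b − 12b² = [log(1+w) − w + w²/2] + [w + 8b − 44b²] − ½[(w+8b)(w−8b)]`
  have total := (hlog.add hw3).sub (hsq.const_mul_left (1 / 2 : ℂ))
  refine total.congr' ?_ EventuallyEq.rfl
  filter_upwards [hev] with τ hτ
  rw [show logLambda τ - π * I * τ - (Real.log 16 : ℝ) + 8 * qhalf τ - 12 * qhalf τ ^ 2 =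
    (logLambda τ - π * I * τ - (Real.log 16 : ℝ)) + 8 * qhalf τ - 12 * qhalf τ ^ 2 by ring, hτ]
  ring

end Literature.NumberTheory.ModularForms
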